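import Summits.AnomalousDissipation.AnomalousDissipation.Theorems.SolenoidalFractalHomogenisationLagrangianStepOneLevelGlue
import Summits.AnomalousDissipation.AnomalousDissipation.Theorems.SolenoidalFractalHomogenisationLagrangianRenormalisationStepExistsL
import Literature.Analysis.FluidPDE.PassiveVectorTensorLionsExistence
import HarnessLib

/-!
# K1L `LagrangianRenormalisationStep` (stmt-AnomalousDissipation-24912) — finding F-p4g7-2: the EXISTENCE conjunct of `stub_oneLevelL` is provable now

Planner `ad-ideate-p4` g7, 2026-08-28.  Sorry-free.

`stub_oneLevelL` (v18) concludes, for every deep level `m`, window shape `S` and class datum `w₀`,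
`(∃ v, TSol E m (k̄_m • renormStep Φ g_{m+1} S) w₀ v) ∧ ∀ u v, … (one-sided drop ratio)`.
The first conjunct is J.-L. Lions' existence theorem for the TENSOR passive-vector class, which the Literature ALREADY has for
every `NearIso 𝔸 lo hi`, `lo > 0` and every essentially bounded a.e.-divergence-free carrier
(`Literature.Analysis.FluidPDE.Torus.exists_isWeakTensorPassiveVectorOn`, file `PassiveVectorTensorLionsExistence.lean`, whose docstring
names exactly this consumer and a lemma `nearIso_smul_renormStep` that did not exist yet), combined with three landed facts:
`renormStep_window` (OneLevelGlue, p614475: the renormalised shape stays in the `λ = 1` window), `NearIso.smul`, and the partial-sum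
carrier package of `…LagrangianRenormalisationStepExistsL` (p611352: `continuous_uncurry_partialSum`, `isWeaklyDivFree_partialSum`,
`memLp_top_stLift_of_continuous`).  Hence:

* `nearIso_smul_renormStep` — the missing lemma (one line);
* `existsL_tensor` — existence of `TSol E m 𝔸 w₀ u` for EVERY `NearIso 𝔸 lo hi`, `lo > 0`, from `E.Regular` (levels continuous + div-free);
* `existsL_renorm` — the existence conjunct of `stub_oneLevelL` verbatim, from `E.LPermissible`-free hypotheses
  (`E.Regular`, `0 ≤ E.gain`, the window clause, `0 < lo`, `1 ≤ Λ`, `0 ≤ β`, `OddSmall S β`, `NearIso S lo hi`, `IsDatum w₀`);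
* `oneLevel_of_oneLevelNoExists` — the ADAPTER: the proposed v19 statement of `stub_oneLevelL` (v18 with the existence conjunct deleted;
  every other binder byte-identical) IMPLIES the registered v18 statement.  So v19's composition is v18's with
  `stub_oneLevelL` replaced by `(oneLevel_of_oneLevelNoExists stub_oneLevelL)` — one token — and the XL− stub loses its S/M-sized
  existence half at zero cost (a weakening again: v18 ⇒ v19 by dropping a conjunct).

Suggested landing: append `nearIso_smul_renormStep`, `existsL_tensor`, `existsL_renorm`, `oneLevel_of_oneLevelNoExists` to the
one-sided glue file the tenure planner asked an idle prover to land (`Theorems/…LagrangianStepOneLevelGlueLower.lean`), or as its own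
`Theorems/…LagrangianStepExistsRenorm.lean` (`--supports stmt-AnomalousDissipation-24912 --as helper`); then register v19.
-/

set_option linter.dupNamespace false
set_option linter.unusedVariables false

namespace Summit.AnomalousDissipation.AnomalousDissipation.Cruxes.LagrangianRenormalisationStep.ExistsRenorm

open Set Filter MeasureTheory Function
open scoped ENNReal NNReal InnerProductSpace
open Literature.Analysis Literature.Analysis.FunctionSpaces Literature.Analysis.FunctionSpaces.Torus
open Literature.Analysis.FluidPDE Literature.Analysis.FluidPDE.LatticeShear
open Summit.AnomalousDissipation.AnomalousDissipation.Theorems.SolenoidalFractalHomogenisation.RealisedQuasiStaticCellLaw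
  (memLp_two_of_memSobolev_one_complexify)
open Summit.AnomalousDissipation.AnomalousDissipation.Theorems.SolenoidalFractalHomogenisation.LagrangianStep
open Summit.AnomalousDissipation.AnomalousDissipation.Theorems.SolenoidalFractalHomogenisation.LagrangianRenormalisationStep
  (memLp_top_stLift_of_continuous continuous_uncurry_partialSum isWeaklyDivFree_partialSum)

noncomputable section

/-- **The missing lemma named in `PassiveVectorTensorLionsExistence`'s docstring.**  The renormalised level-`m` tensor
`c • renormStep Φ g S` is `NearIso (c·lo) (c·hi)` whenever `S` is in the `λ = 1` window, `g ≥ 0`, `c ≥ 0`. -/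
theorem nearIso_smul_renormStep {Φ : FluidPDE.Torus.Visc4 (Fin 3) → FluidPDE.Torus.Visc4 (Fin 3)} {lo hi Λ β : ℝ}
    (hΛ : 1 ≤ Λ) (hβ : 0 ≤ β) (hwin : WindowClause Φ lo hi Λ β) {g : ℝ} (hg : 0 ≤ g)
    {S : FluidPDE.Torus.Visc4 (Fin 3)} (hSo : FluidPDE.Torus.OddSmall S β) (hSn : FluidPDE.Torus.NearIso S lo hi)
    {c : ℝ} (hc : 0 ≤ c) :
    FluidPDE.Torus.NearIso (c • renormStep Φ g S) (c * lo) (c * hi) :=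
  (renormStep_window hΛ hβ hwin hg hSo hSn).2.smul hc

/-- **Existence along the level-`m` partial sum for EVERY window tensor** (Lions): `E.Regular` (levels jointly continuous and weakly
divergence free) and `NearIso 𝔸 lo hi`, `lo > 0`, give a weak solution `TSol E m 𝔸 w₀ u` on `(0,1)` for every `IsDatum w₀`.
[cite: LionsMagenes1972, Chap. 3 Thm. 1.1] -/
theorem existsL_tensor {k : ℕ} (E : LagrangianLatticeCarrier k) (hR : E.Regular) (m : ℕ)
    {𝔸 : FluidPDE.Torus.Visc4 (Fin 3)} {lo hi : ℝ} (h𝔸 : FluidPDE.Torus.NearIso 𝔸 lo hi) (hlo : 0 < lo)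
    (w₀ : VF) (hw₀ : IsDatum w₀) : ∃ u, TSol E m 𝔸 w₀ u := by
  have hc : ∀ i < m, Continuous (uncurry (E.b (i + 1))) := fun i _ => hR.levelRegular.continuous_uncurry_b i
  have hd : ∀ i < m, ∀ t, IsWeaklyDivFree (E.b (i + 1) t) := fun i _ t => hR.levelRegular.isWeaklyDivFree_b i t
  exact FluidPDE.Torus.exists_isWeakTensorPassiveVectorOn one_pos h𝔸 hlo
    (memLp_top_stLift_of_continuous (continuous_uncurry_partialSum E m hc) 1)
    (ae_of_all _ fun t => isWeaklyDivFree_partialSum E m hc hd t)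
    (memLp_two_of_memSobolev_one_complexify hw₀.1) hw₀.2.2

/-- **The existence conjunct of `stub_oneLevelL`, proved.** -/
theorem existsL_renorm {k : ℕ} (E : LagrangianLatticeCarrier k) (hR : E.Regular)
    {Φ : FluidPDE.Torus.Visc4 (Fin 3) → FluidPDE.Torus.Visc4 (Fin 3)} {lo hi Λ β : ℝ}
    (hlo : 0 < lo) (hΛ : 1 ≤ Λ) (hβ : 0 ≤ β) (hwin : WindowClause Φ lo hi Λ β) (hgain : 0 ≤ E.gain) (m : ℕ)
    {S : FluidPDE.Torus.Visc4 (Fin 3)} (hSo : FluidPDE.Torus.OddSmall S β) (hSn : FluidPDE.Torus.NearIso S lo hi)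
    (w₀ : VF) (hw₀ : IsDatum w₀) :
    ∃ v, TSol E m (E.kbar m • renormStep Φ (E.gain / E.cellVisc (m + 1) ^ 2) S) w₀ v :=
  existsL_tensor E hR m
    (nearIso_smul_renormStep hΛ hβ hwin (div_nonneg hgain (sq_nonneg _)) hSo hSn (E.kbar_pos m).le)
    (mul_pos (E.kbar_pos m) hlo) w₀ hw₀

/-- **ADAPTER v19 → v18.**  The proposed v19 statement of `stub_oneLevelL` (hypothesis: v18 with the existence conjunct deleted, all other
binders byte-identical) implies the registered v18 statement (conclusion), the existence being supplied by `existsL_renorm`. -/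
theorem oneLevel_of_oneLevelNoExists
    (hone : ∀ k (W : Literature.Analysis.FluidPDE.LatticeShear.LatticeWord k) (M : ℝ) (hM : 0 < M) (c : ℝ), 0 < c →
    ∀ (Φ : Torus.Visc4 (Fin 3) → Torus.Visc4 (Fin 3)) (lo hi Λ β σ C ν₀ K Cf νf Kf : ℝ),
      0 < lo → lo ≤ 1 → 1 ≤ hi → 1 < Λ → 0 ≤ β → WindowClause Φ lo hi Λ β →
      0 < σ → 0 ≤ C → 0 < ν₀ → 0 < K → SlowVectorClause W M hM c Φ lo hi Λ β σ C ν₀ K →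
      0 ≤ Cf → 0 < νf → 0 < Kf → CellEnergyClauses W M hM c lo hi Λ β Cf νf Kf →
      ∃ ν₁ > (0:ℝ), ∃ K₁ > (0:ℝ), ∃ Λ₀ : ℕ, ∃ θ₀ > (0:ℝ), ∃ C₁ > (0:ℝ), ∃ σ₁ > (0:ℝ),
        ∀ E : Literature.Analysis.FluidPDE.LatticeShear.LagrangianLatticeCarrier k, E.design = W.stretch M hM → E.gain = c → E.nu0 = ν₁ → E.K = K₁ → E.LPermissible → E.Regular → (∀ m, Λ₀ * E.N m ≤ E.N (m + 1)) → (∀ m, E.N m ^ 2 ≤ E.N (m + 1)) → (∀ m, E.cellVisc (m + 1) * ((E.N (m + 1) : ℝ) / E.N m) ^ (1 / 4 : ℝ) ≤ 1) → (∀ m, E.K * ((E.N (m + 1) : ℝ) / E.N m) ^ (1 / 4 : ℝ) ≤ ((E.N (m + 1) : ℝ) / E.N m) * E.cellVisc (m + 1)) → (∀ m, E.θ (m + 1) * ((E.N (m + 1) : ℝ) / E.N m) ^ (1 / 16 : ℝ) ≤ θ₀) → (∀ m, ((E.N (m + 1) : ℝ) / E.N m) ^ (1 / 16 : ℝ) *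 E.physPeriod (m + 1) ≤ E.refresh (m + 1)) →
        ∀ R : ℝ≥0, ∃ mstar : ℕ, ∀ m, mstar ≤ m →
          ∀ S : Torus.Visc4 (Fin 3), Torus.OddSmall S β → Torus.NearIso S lo hi →
          ∀ (w₀ : VF), IsDatum w₀ → InClass R w₀ →
          ∀ u v : ℝ → VF, TSol E (m + 1) (E.kbar (m + 1) • S) w₀ u →
            TSol E m (E.kbar m • renormStep Φ (E.gain / E.cellVisc (m + 1) ^ 2) S) w₀ v →
            ∀ᵐ t ∂(volume.restrict (Ioo (1/2 : ℝ) 1)),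
              (1 - C₁ * ((E.N m : ℝ) / E.N (m + 1)) ^ σ₁) * drop w₀ v t ≤ drop w₀ u t) :
    ∀ k (W : Literature.Analysis.FluidPDE.LatticeShear.LatticeWord k) (M : ℝ) (hM : 0 < M) (c : ℝ), 0 < c →
    ∀ (Φ : Torus.Visc4 (Fin 3) → Torus.Visc4 (Fin 3)) (lo hi Λ β σ C ν₀ K Cf νf Kf : ℝ),
      0 < lo → lo ≤ 1 → 1 ≤ hi → 1 < Λ → 0 ≤ β → WindowClause Φ lo hi Λ β →
      0 < σ → 0 ≤ C → 0 < ν₀ → 0 < K → SlowVectorClause W M hM c Φ lo hi Λ β σ C ν₀ K →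
      0 ≤ Cf → 0 < νf → 0 < Kf → CellEnergyClauses W M hM c lo hi Λ β Cf νf Kf →
      ∃ ν₁ > (0:ℝ), ∃ K₁ > (0:ℝ), ∃ Λ₀ : ℕ, ∃ θ₀ > (0:ℝ), ∃ C₁ > (0:ℝ), ∃ σ₁ > (0:ℝ),
        ∀ E : Literature.Analysis.FluidPDE.LatticeShear.LagrangianLatticeCarrier k, E.design = W.stretch M hM → E.gain = c → E.nu0 = ν₁ → E.K = K₁ → E.LPermissible → E.Regular → (∀ m, Λ₀ * E.N m ≤ E.N (m + 1)) → (∀ m, E.N m ^ 2 ≤ E.N (m + 1)) → (∀ m, E.cellVisc (m + 1) * ((E.N (m + 1) : ℝ) / E.N m) ^ (1 / 4 : ℝ) ≤ 1) → (∀ m, E.K * ((E.N (m + 1) : ℝ) / E.N m) ^ (1 / 4 : ℝ) ≤ ((E.N (m + 1) : ℝ) / E.N m) * E.cellVisc (m + 1)) → (∀ m, E.θ (m + 1) * ((E.N (m + 1) : ℝ) / E.N m) ^ (1 / 16 : ℝ) ≤ θ₀) → (∀ m, ((E.N (m + 1) : ℝ) / E.N m) ^ (1 / 16 : ℝ) *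 E.physPeriod (m + 1) ≤ E.refresh (m + 1)) →
        ∀ R : ℝ≥0, ∃ mstar : ℕ, ∀ m, mstar ≤ m →
          ∀ S : Torus.Visc4 (Fin 3), Torus.OddSmall S β → Torus.NearIso S lo hi →
          ∀ (w₀ : VF), IsDatum w₀ → InClass R w₀ →
          (∃ v, TSol E m (E.kbar m • renormStep Φ (E.gain / E.cellVisc (m + 1) ^ 2) S) w₀ v) ∧
          ∀ u v : ℝ → VF, TSol E (m + 1) (E.kbar (m + 1) • S) w₀ u →
            TSol E m (E.kbar m • renormStep Φ (E.gain / E.cellVisc (m + 1) ^ 2) S) w₀ v →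
            ∀ᵐ t ∂(volume.restrict (Ioo (1/2 : ℝ) 1)),
              (1 - C₁ * ((E.N m : ℝ) / E.N (m + 1)) ^ σ₁) * drop w₀ v t ≤ drop w₀ u t := by
  intro k W M hM c hc Φ lo hi Λ β σ C ν₀ K Cf νf Kf hlo hlo1 hhi1 hΛ hβ hwin hσ hC hν₀ hK hV hCf hνf hKf hEcl
  obtain ⟨ν₁, hν₁, K₁, hK₁, Λ₀, θ₀, hθ₀, C₁, hC₁, σ₁, hσ₁, hE⟩ :=
    hone k W M hM c hc Φ lo hi Λ β σ C ν₀ K Cf νf Kf hlo hlo1 hhi1 hΛ hβ hwin hσ hC hν₀ hK hV hCf hνf hKf hEcl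
  refine ⟨ν₁, hν₁, K₁, hK₁, Λ₀, θ₀, hθ₀, C₁, hC₁, σ₁, hσ₁, fun E hW hg hn hK' hP hR h1 h2 h3 h4 h5 h6 R => ?_⟩
  obtain ⟨mstar, hm⟩ := hE E hW hg hn hK' hP hR h1 h2 h3 h4 h5 h6 R
  refine ⟨mstar, fun m hmm S hSo hSn w₀ hD hCl => ⟨?_, hm m hmm S hSo hSn w₀ hD hCl⟩⟩
  have hgain : 0 ≤ E.gain := by rw [hg]; exact hc.le
  exact existsL_renorm E hR hlo hΛ.le hβ hwin hgain m hSo hSn w₀ hD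

end

end Summit.AnomalousDissipation.AnomalousDissipation.Cruxes.LagrangianRenormalisationStep.ExistsRenorm
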